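import Mathlib
import HarnessLib
import Summits.ResolutionOfSingularities.ResolutionOfSingularities.Theorems.WildQuotientsWildQuotientResolutionJordanFourConePresentations
import Summits.ResolutionOfSingularities.ResolutionOfSingularities.Theorems.WildQuotientsWildQuotientResolutionJordanFourTwistedChartInvariants
import Summits.ResolutionOfSingularities.ResolutionOfSingularities.Theorems.WildQuotientsWildQuotientResolutionJordanFourParity
import Summits.ResolutionOfSingularities.ResolutionOfSingularities.Theorems.WildQuotientsWildQuotientResolutionHalf111BlowupAway
import Summits.ResolutionOfSingularities.ResolutionOfSingularities.Theorems.WildQuotientsWildQuotientResolutionJordanFourConeVertexContraction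
import Summits.ResolutionOfSingularities.ResolutionOfSingularities.Theorems.WildQuotientsWildQuotientResolutionConeVertexAwayContraction

/-!
# V4U brick `H₁`, algebra (2): the `½(1,1,1)` cone localised at `Q` — the ring `R₀`, its vertex ideal
# `J₀`, and the contraction `(X a, X b, X c) ↦ J₀` along the invariant subring of the twisted chart
(crux stmt-ResolutionOfSingularities-15640 `WildQuotients.WildQuotientResolution`, line `Sketch`;
chain w45c programme V4U, `L/w45c/CHAIN.md` v7.6 §4, brick `H₁` = lead-1 p505172
`BlowupExit.exists_isBlowup_regular_of_vertexPresentation` hypothesis `H` at the `μ₂` piece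
`O₁ = W_T`, ORDER res-L1-w45c-plan-1 RULING v7.5a/CORRECTION 2026-08-27T06:30:44Z → res-type-036;
[OURS · L1 W4.5c] — NOT a statement of any manuscript; replaces the role of no printed item.)

THE CONE SIDE OF `H₁`. Fix the twisted chart's invariant subring
`S_T = JordanFour.invSubalgebraT k n a b c τ ⊆ k[x]` (even ∩ `Σ_T`-fixed; res-L1-w45c-stub-1
p507494, = res-L1-w45c-stub-1 p501651's `adjoin k {s², sA, sN, A², AN, N², passengers}`) with its
presentation `φ_T : k[Y] ⧸ ker (Half111.presentation k n b a c) ≃ₐ S_T` (`JordanFour.phiT`), the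
invariant unit `Q = JordanFour.twistedQ ∈ S_T`, any localisation `S` of `S_T` at `Q` (the ring `R₀` of
the brick) and any localisation `T` of `k[x]` at `Q` (the ambient `L_Q` of res-L1-w45c-stub-2's `E_Q`):

* `comap_substN_span_X_abc` — `S_N⁻¹ (X a, X b, X c) = (X a, X b, X c)` for res-type-087's Artin–Schreier
  slot substitution `S_N` (p503660);
* `twistedQ_mem_invSubalgebraT`, `twistedQ_not_mem_span_X_abc`;
* `comap_val_invSubalgebraT_span_X_abc` — `(X a, X b, X c) ∩ S_T = φ_T(𝔪₂)`, `𝔪₂` the vertex ideal of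
  the presented cone (res-L1-w45c-stub-4 (γ) `Half111.comap_lift_span_X`, p504476, + `S_N`);
* **`exists_halfConeVertexIdeal`** — THE CONE DATA OF `H₁`: an ideal `J₀ ⊆ S` which is PRIME, whose
  affine blow-up `Bl_{J₀}(Spec S)` is REGULAR (stub-4 (α½)/(β) `Half111.isPrime_map_span_gens` /
  `isRegular_affineBlowup_map_away`, p503613/p504195, transported along `φ_T`), and which is EXACTLY
  the contraction of `(X a, X b, X c)·T` along the localised inclusion `S → T`
  (stub-4 (O-b) `ConeVertex.comap_awayMap_map`, p505345).
With res-type-036's `JordanFour.radical_span_twistedVertex_eq` (root-chart side, p508119) this is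
the radical identity `√(ψ⁻¹(𝔞·Γ(O₁))) = J₀` of `H₁` up to the chart dictionary (res-L1-w45c-stub-2
T2(b) + res-L1-w45c-stub-5's seam).
-/

-- single-problem summit: the doubled namespace component `ResolutionOfSingularities` is forced
set_option linter.dupNamespace false

noncomputable section

open MvPolynomial AlgebraicGeometry Literature.AlgebraicGeometry.Resolution

namespace Summit.ResolutionOfSingularities.ResolutionOfSingularities.Theorems.WildQuotientResolution.JordanFour

variable (k : Type) [Field k] (n : ℕ) (a b c d : Fin n)

/-! ## `S_N⁻¹ (X a, X b, X c) = (X a, X b, X c)` -/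

/-- `(range (passenger inclusion))ᶜ = {a, b, c}`. [folklore] -/
theorem compl_range_passengerIncl_eq :
    (Set.range (fun i : {i : Fin n // i ≠ a ∧ i ≠ b ∧ i ≠ c} => (i.1 : Fin n)))ᶜ =
      ({a, b, c} : Set (Fin n)) := by
  ext i
  simp only [Set.mem_compl_iff, Set.mem_range, not_exists, Set.mem_insert_iff,
    Set.mem_singleton_iff]
  constructor
  · intro h
    by_contra h'
    push Not at h'
    exact h ⟨i, h'⟩ rfl
  · rintro (rfl | rfl | rfl) ⟨j, hj⟩ hji <;> simp only at hji <;> subst hji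
    exacts [hj.1 rfl, hj.2.1 rfl, hj.2.2 rfl]

/-- `(X a, X b, X c)` is the kernel of killing the three variables. [folklore] -/
theorem span_X_abc_eq_ker_killCompl :
    Ideal.span {(X a : MvPolynomial (Fin n) k), X b, X c} =
      RingHom.ker (killCompl (R := k)
        (f := fun i : {i : Fin n // i ≠ a ∧ i ≠ b ∧ i ≠ c} => (i.1 : Fin n))
        (fun _ _ h => Subtype.ext h)).toRingHom := by
  rw [ConeVertex.ker_killCompl_eq_span, compl_range_passengerIncl_eq, Third112.X_triple_eq_image]

/-- **`S_N⁻¹ (X a, X b, X c) = (X a, X b, X c)`** for the Artin–Schreier slot substitution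
`S_N : X c ↦ X c ^ p − X b ^ (p−1) X c` (res-type-087 `JordanFour.substN`): killing `X a, X b, X c`
is unchanged by precomposition with `S_N`. [OURS · L1 W4.5c] [folklore] -/
theorem comap_substN_span_X_abc (p : ℕ) (hp : 1 ≤ p) :
    Ideal.comap (substN k n b c p) (Ideal.span {(X a : MvPolynomial (Fin n) k), X b, X c}) =
      Ideal.span {(X a : MvPolynomial (Fin n) k), X b, X c} := by
  classical
  set κ := killCompl (R := k)
        (f := fun i : {i : Fin n // i ≠ a ∧ i ≠ b ∧ i ≠ c} => (i.1 : Fin n))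
        (fun i j h => Subtype.ext h) with hκ
  have hκc : κ (X c) = 0 := by
    have : (X c : MvPolynomial (Fin n) k) ∈ RingHom.ker κ.toRingHom := by
      rw [← span_X_abc_eq_ker_killCompl]
      exact Ideal.subset_span (by simp)
    exact this
  have hcomp : κ.comp (substN k n b c p) = κ := by
    refine MvPolynomial.algHom_ext fun i => ?_
    rw [AlgHom.comp_apply, substN_X]
    split_ifs with hic
    · subst hic
      rw [map_sub, map_mul, map_pow, map_pow, hκc, zero_pow (by omega), mul_zero, sub_zero]
    · rfl
  rw [span_X_abc_eq_ker_killCompl]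
  change Ideal.comap (substN k n b c p).toRingHom (RingHom.ker κ.toRingHom) = RingHom.ker κ.toRingHom
  rw [RingHom.comap_ker]
  change RingHom.ker (κ.comp (substN k n b c p)).toRingHom = _
  rw [hcomp]

/-! ## `Q ∈ S_T`, `Q ∉ (X a, X b, X c)` -/

section PieceT

variable (τ : MvPolynomial (Fin n) k →ₐ[k] MvPolynomial (Fin n) k)
  (hab : a ≠ b) (hac : a ≠ c) (hbc : b ≠ c) (had : a ≠ d) (hbd : b ≠ d) (hcd : c ≠ d)
  (hτc : τ (X c) = X c + X b) (hτ : ∀ i, i ≠ c → τ (X i) = X i)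

include hab hac had hbc hbd hcd hτ in
/-- `Q = 1 − 3sA + A²η ∈ S_T` (even and `Σ_T`-invariant; `2 ∈ kˣ`). [OURS · L1 W4.5c] [folklore] -/
theorem twistedQ_mem_invSubalgebraT (h2 : (2 : k) ≠ 0) :
    twistedQ k n a b d ∈ invSubalgebraT k n a b c τ := by
  rw [mem_invSubalgebraT_iff]
  exact ⟨twistedQ_mem_adjoin_evenGens k n a b c d hab hac had hbc hbd hcd h2,
    translate_twistedQ k n a b c d τ hτ hac hbc hcd⟩

/-- `Q ∉ (X a, X b, X c)` (its constant term is `1`). [folklore] -/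
theorem twistedQ_not_mem_span_X_abc :
    twistedQ k n a b d ∉ Ideal.span {(X a : MvPolynomial (Fin n) k), X b, X c} := by
  intro h
  have hle : Ideal.span {(X a : MvPolynomial (Fin n) k), X b, X c} ≤
      RingHom.ker (constantCoeff : MvPolynomial (Fin n) k →+* k) := by
    rw [Ideal.span_le]
    rintro x hx
    simp only [Set.mem_insert_iff, Set.mem_singleton_iff] at hx
    rcases hx with rfl | rfl | rfl <;> simp [RingHom.mem_ker]
  have h1 := hle h
  rw [RingHom.mem_ker, twistedQ] at h1
  simp at h1

include hab hac hbc hτc hτ in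
/-- **`(X a, X b, X c) ∩ S_T = φ_T(𝔪₂)`**: the vertex ideal of the presented `½(1,1,1)` cone
(triple `(b, a, c)`; `𝔪₂` = the span of the six generator classes) is carried by `φ_T` onto the
contraction of `(X a, X b, X c)` to the invariant subring `S_T` (res-L1-w45c-stub-4 (γ)
`Half111.comap_lift_span_X`, p504476, read through `S_N`, `comap_substN_span_X_abc`).
[OURS · L1 W4.5c] [folklore] -/
theorem comap_val_invSubalgebraT_span_X_abc (p : ℕ) (hp : p.Prime) (hp2 : p ≠ 2) [CharP k p] :
    Ideal.comap (invSubalgebraT k n a b c τ).val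
        (Ideal.span {(X a : MvPolynomial (Fin n) k), X b, X c}) =
      Ideal.map (phiT k n a b c τ hab hac hbc hτc hτ p hp hp2).toRingEquiv
        (Ideal.span (Set.range (fun l : Fin 6 =>
          Ideal.Quotient.mk (RingHom.ker (Half111.presentation k n b a c))
            (Half111.gens k n b a c l)))) := by
  set φ := phiT k n a b c τ hab hac hbc hτc hτ p hp hp2 with hφ
  ext x
  obtain ⟨y, rfl⟩ : ∃ y, φ y = x := φ.surjective x
  obtain ⟨P, rfl⟩ := Ideal.Quotient.mk_surjective y
  have h1 : (invSubalgebraT k n a b c τ).val (φ (Ideal.Quotient.mk _ P)) =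
      substN k n b c p (Half111.presentation k n b a c P) :=
    coe_phiT_mk k n a b c τ hab hac hbc hτc hτ p hp hp2 P
  have key : Ideal.Quotient.mk (RingHom.ker (Half111.presentation k n b a c)) P ∈
      Ideal.span (Set.range (fun l : Fin 6 =>
          Ideal.Quotient.mk (RingHom.ker (Half111.presentation k n b a c))
            (Half111.gens k n b a c l))) ↔
      Half111.presentation k n b a c P ∈ Ideal.span {(X b : MvPolynomial (Fin n) k), X a, X c} := by
    rw [← Half111.comap_lift_span_X k n b a c hab.symm hac hbc]
    rfl
  rw [Ideal.mem_comap, h1, show φ (Ideal.Quotient.mk _ P) = φ.toRingEquiv (Ideal.Quotient.mk _ P)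
    from rfl, Ideal.apply_mem_of_equiv_iff, key,
    show ({(X b : MvPolynomial (Fin n) k), X a, X c} : Set (MvPolynomial (Fin n) k)) = {X a, X b, X c}
      from Set.insert_comm _ _ _]
  conv_rhs => rw [← comap_substN_span_X_abc k n a b c p hp.one_lt.le]
  rw [Ideal.mem_comap]

include hab hac hbc hτc hτ in
/-- **THE CONE DATA OF `H₁`.** For any localisation `S` of the invariant subring `S_T` at `Q` (the
ring `R₀` of the `μ₂` brick) and any localisation `T` of `k[x]` at `Q` (the ambient of the chart
model `E_Q`), there is an ideal `J₀ ⊆ S` — the vertex ideal `𝔪₂` of the presented `½(1,1,1)` cone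
carried along `φ_T` and extended to `S` — which is PRIME (res-L1-w45c-stub-4 (α½)
`Half111.isPrime_map_span_gens`), whose affine blow-up is REGULAR (stub-4 (β)
`Half111.isRegular_affineBlowup_map_away`, p504195), and which is EXACTLY the contraction of
`(X a, X b, X c)·T` along the localised inclusion `S → T` (stub-4 (O-b) `ConeVertex.comap_awayMap_map`,
p505345, + `comap_val_invSubalgebraT_span_X_abc`). [OURS · L1 W4.5c] [folklore] -/
theorem exists_halfConeVertexIdeal (p : ℕ) (hp : p.Prime) (hp2 : p ≠ 2) [CharP k p]
    (hQ : twistedQ k n a b d ∈ invSubalgebraT k n a b c τ)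
    (S : Type) [CommRing S] [Algebra (invSubalgebraT k n a b c τ) S]
    [IsLocalization.Away (⟨twistedQ k n a b d, hQ⟩ : invSubalgebraT k n a b c τ) S]
    (T : Type) [CommRing T] [Algebra (MvPolynomial (Fin n) k) T]
    [IsLocalization.Away ((invSubalgebraT k n a b c τ).val.toRingHom
      (⟨twistedQ k n a b d, hQ⟩ : invSubalgebraT k n a b c τ)) T] :
    ∃ J₀ : Ideal S, J₀.IsPrime ∧ Scheme.IsRegular (affineBlowup J₀) ∧
      Ideal.comap (IsLocalization.Away.map S T (invSubalgebraT k n a b c τ).val.toRingHom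
          (⟨twistedQ k n a b d, hQ⟩ : invSubalgebraT k n a b c τ))
        ((Ideal.span {(X a : MvPolynomial (Fin n) k), X b, X c}).map
          (algebraMap (MvPolynomial (Fin n) k) T)) = J₀ := by
  classical
  set φ := phiT k n a b c τ hab hac hbc hτc hτ p hp hp2 with hφ
  letI algAS : Algebra (MvPolynomial (Fin n ⊕ Fin 3) k ⧸ RingHom.ker (Half111.presentation k n b a c)) S :=
    ((algebraMap (invSubalgebraT k n a b c τ) S).comp φ.toRingEquiv.symm.symm.toRingHom).toAlgebra
  set q : MvPolynomial (Fin n ⊕ Fin 3) k ⧸ RingHom.ker (Half111.presentation k n b a c) :=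
    φ.toRingEquiv.symm ⟨twistedQ k n a b d, hQ⟩ with hq
  haveI hlocS : IsLocalization.Away q S := by
    have h := IsLocalization.isLocalization_of_base_ringEquiv
      (Submonoid.powers ((⟨twistedQ k n a b d, hQ⟩ : invSubalgebraT k n a b c τ))) S
      φ.toRingEquiv.symm
    rw [Submonoid.map_powers] at h
    exact h
  have hq' : q ∉ Ideal.span (Set.range (fun l : Fin 6 =>
      Ideal.Quotient.mk (RingHom.ker (Half111.presentation k n b a c)) (Half111.gens k n b a c l))) := by
    intro hmem
    have h1 : φ.toRingEquiv q ∈ Ideal.map φ.toRingEquiv (Ideal.span (Set.range (fun l : Fin 6 =>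
        Ideal.Quotient.mk (RingHom.ker (Half111.presentation k n b a c)) (Half111.gens k n b a c l)))) :=
      Ideal.apply_mem_of_equiv_iff.mpr hmem
    rw [← comap_val_invSubalgebraT_span_X_abc k n a b c τ hab hac hbc hτc hτ p hp hp2,
      Ideal.mem_comap, hq, RingEquiv.apply_symm_apply] at h1
    exact twistedQ_not_mem_span_X_abc k n a b c d h1
  refine ⟨Ideal.map (algebraMap _ S) (Ideal.span (Set.range (fun l : Fin 6 =>
      Ideal.Quotient.mk (RingHom.ker (Half111.presentation k n b a c)) (Half111.gens k n b a c l)))),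
    Half111.isPrime_map_span_gens k n b a c S q hq',
    Half111.isRegular_affineBlowup_map_away k n b a c hab.symm hac hbc S q, ?_⟩
  rw [ConeVertex.comap_awayMap_map (invSubalgebraT k n a b c τ).val.toRingHom
      (⟨twistedQ k n a b d, hQ⟩ : invSubalgebraT k n a b c τ) (Ideal.span {(X a : MvPolynomial (Fin n) k), X b, X c}),
    AlgHom.toRingHom_eq_coe, Ideal.comap_coe,
    comap_val_invSubalgebraT_span_X_abc k n a b c τ hab hac hbc hτc hτ p hp hp2,
    RingHom.algebraMap_toAlgebra, ← Ideal.map_map, RingEquiv.symm_symm, RingEquiv.toRingHom_eq_coe,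
    Ideal.map_coe]

end PieceT

end Summit.ResolutionOfSingularities.ResolutionOfSingularities.Theorems.WildQuotientResolution.JordanFour

end
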